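import Mathlib
import HarnessLib
import Summits.ResolutionOfSingularities.ResolutionOfSingularities.Theorems.WildQuotientsWildQuotientResolutionConductorOneFrameCentre

/-!
# S2 brick F3b — the FRAME of the conductor-𝟙 core: the stable affine pieces `O_I = D₊(s_I)` and their cover

(crux stmt-ResolutionOfSingularities-15640 `WildQuotients.WildQuotientResolution`, line `Sketch`; chain w45c post-V5
programme S2, design `L/res-L1-w45c-lead-1/S2-DESIGN.md` §1 «THE FRAME» («`O_{i,ε} := V[uᵢ] ∩ ⋂_{ε_j=1} D(t_j) ∩
⋂_{ε_j=0} D(1−t_j)` — affine, `σ̃`-STABLE, and these cover `V`: given `v`, `i` an index with `v ∈ V[uᵢ]`,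
`ε_j := [t_j(v) ≠ 0]`») / §6 brick F3; res-L1-w45c-plan-1 RULING 2026-08-27T18:23:36Z. [OURS · L1 W4.5c] — NOT a
statement of any manuscript; replaces the role of no printed item; AI-produced, weaker than expert review. Def-free.
Prover res-D-pv-033.)

`R := CoreRing k p n`, `𝔪 := Ideal.span (Set.range (coreU k p n))`, `V := Proj (R[𝔪 t])`; `uT l := uₗ t`,
`dT i l := (uᵢ − uₗ) t` (`t_l = uT l / uT i`, `1 − t_l = dT i l / uT i` on `V[uᵢ]`). For `I ⊆ Fin n` and a base
index `i` the PIECE is the single Rees chart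
  `O i I := D₊(pieceElt i I)`, `pieceElt i I := uT i · ∏_{l ∈ I.erase i} uT l · ∏_{l ∉ I} dT i l`
(`= V[uᵢ] ∩ D(∏_{l ∈ I∖i} t_l) ∩ D(∏_{l ∉ I} (1 − t_l))`; the frame takes `i = I.min' hI`).
* `basicOpen_finset_prod` (generic) — `D₊(∏_{l∈S} f l) = S.inf (D₊ ∘ f)`;
* `pieceElt_mem` — `pieceElt i I ∈ R[𝔪t]_{1 + |I.erase i|·1 + |Iᶜ|·1}` (positive degree), `isAffineOpen_piece`;
* `piece_eq_inf` — `O i I = D₊(uT i) ⊓ (I.erase i).inf (D₊ ∘ uT) ⊓ (univ∖I).inf (D₊ ∘ dT i)`, `piece_le_vertexChart`;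
* `exists_unit_zpow_of_mul_unit` / `preimage_basicOpen_reesT_eq_of_units` — a Rees chart `D₊(x t)` whose generator
  is moved to UNIT multiples by `σ^{±1}` is stable; `sigma_coreDiff_eq_mul_unit` / `symm_coreDiff_eq_mul_unit` —
  `σ^{±1}(uᵢ − uₗ) = (uᵢ − uₗ)·unit`; hence **`preimage_piece_eq`** — every `O i I` is `⟨σ⟩`-STABLE;
* **`iSup_piece_eq_top`** — the pieces `O (I.min' hI) I`, `I` non-empty, COVER `V` (for `v ∈ V` take
  `I := {l | v ∈ D₊(uT l)}` — non-empty by the vertex cover; for `l ∉ I`, `uₗt ∈ 𝔭_v ∌ uᵢt` forces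
  `(uᵢ − uₗ)t ∉ 𝔭_v`).
-/

-- single-problem summit: the doubled namespace component `ResolutionOfSingularities` is forced
set_option linter.dupNamespace false

noncomputable section

open CategoryTheory AlgebraicGeometry TopologicalSpace MvPolynomial Polynomial
open scoped Pointwise
open Literature.AlgebraicGeometry.Resolution

universe u

namespace Summit.ResolutionOfSingularities.ResolutionOfSingularities.Theorems.WildQuotientResolution

namespace BlowupExit

/-- `D₊(∏_{l ∈ S} f l) = S.inf (D₊ ∘ f)` on `Proj 𝒜`. [folklore] -/
theorem basicOpen_finset_prod {A σ' : Type*} [CommRing A] [SetLike σ' A] [AddSubgroupClass σ' A]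
    (𝒜 : ℕ → σ') [GradedRing 𝒜] {ι : Type*} [DecidableEq ι] (S : Finset ι) (f : ι → A) :
    Proj.basicOpen 𝒜 (∏ l ∈ S, f l) = S.inf (fun l => Proj.basicOpen 𝒜 (f l)) := by
  induction S using Finset.induction_on with
  | empty => rw [Finset.prod_empty, Finset.inf_empty, Proj.basicOpen_one]
  | insert a S ha ih => rw [Finset.prod_insert ha, Finset.inf_insert, Proj.basicOpen_mul, ih]

/-- Powers of an automorphism move `x` to unit multiples of `x` as soon as `σ` and `σ⁻¹` do. [folklore] -/
theorem exists_unit_zpow_of_mul_unit {R : Type*} [CommRing R] {k : Type*} [CommSemiring k] [Algebra k R]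
    (σ : R ≃ₐ[k] R) (x : R) (c c' : Rˣ) (h1 : σ x = x * c) (h2 : σ.symm x = x * c') (z : ℤ) :
    ∃ d : Rˣ, (σ ^ z) x = x * d := by
  induction z using Int.induction_on with
  | zero => exact ⟨1, by simp⟩
  | succ j ih =>
    obtain ⟨d, hd⟩ := ih
    refine ⟨c * Units.map (σ : R →* R) d, ?_⟩
    rw [show (j : ℤ) + 1 = 1 + j from add_comm _ _, zpow_one_add, AlgEquiv.mul_apply, hd, map_mul, h1,
      Units.val_mul, Units.coe_map, mul_assoc]
    rfl
  | pred j ih =>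
    obtain ⟨d, hd⟩ := ih
    refine ⟨c' * Units.map (σ.symm : R →* R) d, ?_⟩
    rw [show (-(j : ℤ) - 1) = (-1) + (-j) by ring, zpow_add, zpow_neg_one, AlgEquiv.mul_apply, AlgEquiv.aut_inv,
      hd, map_mul, h2, Units.val_mul, Units.coe_map, mul_assoc]
    rfl

/-- **A Rees chart `D₊(x t)` whose generator `σ^{±1}` moves to unit multiples is `⟨σ⟩`-stable** (affine-quotient
law; `hJ` abstract). [folklore] -/
theorem preimage_basicOpen_reesT_eq_of_units {R : Type u} [CommRing R] {k : Type} [Field k] [Algebra k R]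
    (σ : R ≃ₐ[k] R) {I : Ideal R}
    (ρ : ↥(Subgroup.zpowers σ) →* Aut (Spec (CommRingCat.of R)))
    (hρ : ∀ γ : ↥(Subgroup.zpowers σ), (ρ γ).hom = Spec.map (CommRingCat.ofHom
      ((MulSemiringAction.toRingEquiv (↥(Subgroup.zpowers σ)) R γ⁻¹ : R ≃+* R) : R →+* R)))
    (hJ : ∀ γ : ↥(Subgroup.zpowers σ), (affineBlowup.idealSheaf I).comap (ρ γ).hom = affineBlowup.idealSheaf I)
    {x : R} (hx : x ∈ I) (c c' : Rˣ) (h1 : σ x = x * c) (h2 : σ.symm x = x * c') (γ : ↥(Subgroup.zpowers σ)) :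
    (((affineBlowup.isBlowup I).liftAction ρ hJ) γ).hom ⁻¹ᵁ Proj.basicOpen (reesGrading I) (reesT x hx) =
      Proj.basicOpen (reesGrading I) (reesT x hx) := by
  obtain ⟨z, hz⟩ := Subgroup.mem_zpowers_iff.mp (γ⁻¹).2
  obtain ⟨d, hd⟩ := exists_unit_zpow_of_mul_unit σ x c c' h1 h2 z
  have hsm : γ⁻¹ • x = x * d := by
    change ((γ⁻¹ : ↥(Subgroup.zpowers σ)) : R ≃ₐ[k] R) x = _
    rw [← hz]; exact hd
  have hmem : γ⁻¹ • x ∈ I := by rw [hsm]; exact I.mul_mem_right _ hx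
  rw [preimage_basicOpen_reesT_liftAction ρ hρ hJ _ γ hmem]
  have key : ∀ (y : R) (hy : y ∈ I) (e : y = x * d),
      Proj.basicOpen (reesGrading I) (reesT y hy) =
        Proj.basicOpen (reesGrading I) (reesT (x * d) (by rw [← e]; exact hy)) := by
    rintro y hy rfl; rfl
  rw [key _ hmem hsm]
  exact basicOpen_reesT_mul_unit _ d _

end BlowupExit

namespace ConductorOne

variable (k : Type) [Field k] (p n : ℕ) [Fact p.Prime] [CharP k p]
  (σ : CoreRing k p n ≃ₐ[k] CoreRing k p n)
  (hσ : ∀ i, σ (coreU k p n i) * (1 + coreU k p n i) = coreU k p n i)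

/-- the Rees generator `uₗ t` -/
local notation3 (prettyPrint := false) "uT" l =>
  reesT (I := Ideal.span (Set.range (coreU k p n))) (coreU k p n l)
    (Ideal.mem_span_range_self (f := coreU k p n) (x := l))
/-- the Rees element `(uᵢ − uₗ) t` -/
local notation3 (prettyPrint := false) "dT" i:max l:max =>
  reesT (I := Ideal.span (Set.range (coreU k p n))) (coreU k p n i - coreU k p n l)
    (Ideal.sub_mem _ (Ideal.mem_span_range_self (f := coreU k p n) (x := i))
      (Ideal.mem_span_range_self (f := coreU k p n) (x := l)))
/-- the Rees chart `D₊(y)` -/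
local notation3 (prettyPrint := false) "D₊" y =>
  Proj.basicOpen (reesGrading (Ideal.span (Set.range (coreU k p n)))) y
/-- the piece element `s_{i,I} = uᵢt · ∏_{l ∈ I∖i} uₗt · ∏_{l ∉ I} (uᵢ − uₗ)t` -/
local notation3 (prettyPrint := false) "pieceElt" i:max I:max =>
  (uT i) * (∏ l ∈ Finset.erase I i, (uT l)) * (∏ l ∈ Finset.univ \ I, (dT i l))

omit [Fact p.Prime] [CharP k p] in
/-- The piece element has degree `1 + |I∖i| + |Iᶜ|` (`= n` when `i ∈ I`). [OURS · L1 W4.5c] -/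
theorem pieceElt_mem (i : Fin n) (I : Finset (Fin n)) :
    (pieceElt i I) ∈ reesGrading (Ideal.span (Set.range (coreU k p n)))
      (1 + ∑ _l ∈ I.erase i, 1 + ∑ _l ∈ Finset.univ \ I, 1) :=
  SetLike.mul_mem_graded (SetLike.mul_mem_graded (reesT_mem _ _)
    (SetLike.prod_mem_graded _ _ _ fun _ _ => reesT_mem _ _))
    (SetLike.prod_mem_graded _ _ _ fun _ _ => reesT_mem _ _)

omit [Fact p.Prime] [CharP k p] in
/-- **`O_{i,I} = D₊(s_{i,I})` is affine.** [OURS · L1 W4.5c] -/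
theorem isAffineOpen_piece (i : Fin n) (I : Finset (Fin n)) : IsAffineOpen (D₊ (pieceElt i I)) :=
  Proj.isAffineOpen_basicOpen _ _ (pieceElt_mem k p n i I) (by positivity)

omit [Fact p.Prime] [CharP k p] in
/-- `O_{i,I} = V[uᵢ] ∩ ⋂_{l ∈ I∖i} D₊(uₗt) ∩ ⋂_{l ∉ I} D₊((uᵢ−uₗ)t)`. [OURS · L1 W4.5c] -/
theorem piece_eq_inf (i : Fin n) (I : Finset (Fin n)) :
    (D₊ (pieceElt i I)) = (D₊ (uT i)) ⊓ (I.erase i).inf (fun l => D₊ (uT l)) ⊓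
      (Finset.univ \ I).inf (fun l => D₊ (dT i l)) := by
  rw [Proj.basicOpen_mul, Proj.basicOpen_mul, BlowupExit.basicOpen_finset_prod, BlowupExit.basicOpen_finset_prod]

omit [Fact p.Prime] [CharP k p] in
/-- `O_{i,I} ≤ V[uᵢ]`. [OURS · L1 W4.5c] -/
theorem piece_le_vertexChart (i : Fin n) (I : Finset (Fin n)) : (D₊ (pieceElt i I)) ≤ (D₊ (uT i)) := by
  rw [piece_eq_inf]; exact inf_le_left.trans inf_le_left

/-! ## Stability -/

include hσ in
/-- `σ (uᵢ − uₗ) = (uᵢ − uₗ) · ((1+uᵢ)(1+uₗ))⁻¹`. [OURS · L1 W4.5c] -/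
theorem sigma_coreDiff_eq_mul_unit (i l : Fin n) :
    σ (coreU k p n i - coreU k p n l) = (coreU k p n i - coreU k p n l) *
      ↑(((isUnit_one_add_coreU k p n i).unit * (isUnit_one_add_coreU k p n l).unit)⁻¹) := by
  have e : σ (coreU k p n i - coreU k p n l) * ((1 + coreU k p n i) * (1 + coreU k p n l)) =
      coreU k p n i - coreU k p n l := by
    rw [map_sub]; linear_combination (1 + coreU k p n l) * hσ i - (1 + coreU k p n i) * hσ l
  have hu := ((isUnit_one_add_coreU k p n i).unit * (isUnit_one_add_coreU k p n l).unit).mul_inv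
  rw [Units.val_mul, IsUnit.unit_spec, IsUnit.unit_spec] at hu
  calc σ (coreU k p n i - coreU k p n l)
      = σ (coreU k p n i - coreU k p n l) * (((1 + coreU k p n i) * (1 + coreU k p n l)) *
          ↑(((isUnit_one_add_coreU k p n i).unit * (isUnit_one_add_coreU k p n l).unit)⁻¹)) := by
        rw [hu, mul_one]
    _ = _ := by rw [← mul_assoc, e]

omit [CharP k p] in
include hσ in
/-- `σ⁻¹ (uᵢ − uₗ) = (uᵢ − uₗ) · ((1−uᵢ)(1−uₗ))⁻¹`. [OURS · L1 W4.5c] -/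
theorem symm_coreDiff_eq_mul_unit (i l : Fin n) :
    σ.symm (coreU k p n i - coreU k p n l) = (coreU k p n i - coreU k p n l) *
      ↑(((isUnit_one_sub_coreU k p n i).unit * (isUnit_one_sub_coreU k p n l).unit)⁻¹) := by
  have law : ∀ j, σ.symm (coreU k p n j) * (1 - coreU k p n j) = coreU k p n j := by
    intro j
    have h := congrArg σ.symm (hσ j)
    rw [map_mul, map_add, map_one, σ.symm_apply_apply] at h
    linear_combination -h
  have e : σ.symm (coreU k p n i - coreU k p n l) * ((1 - coreU k p n i) * (1 - coreU k p n l)) =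
      coreU k p n i - coreU k p n l := by
    rw [map_sub]; linear_combination (1 - coreU k p n l) * law i - (1 - coreU k p n i) * law l
  have hu := ((isUnit_one_sub_coreU k p n i).unit * (isUnit_one_sub_coreU k p n l).unit).mul_inv
  rw [Units.val_mul, IsUnit.unit_spec, IsUnit.unit_spec] at hu
  calc σ.symm (coreU k p n i - coreU k p n l)
      = σ.symm (coreU k p n i - coreU k p n l) * (((1 - coreU k p n i) * (1 - coreU k p n l)) *
          ↑(((isUnit_one_sub_coreU k p n i).unit * (isUnit_one_sub_coreU k p n l).unit)⁻¹)) := by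
        rw [hu, mul_one]
    _ = _ := by rw [← mul_assoc, e]

omit [Fact p.Prime] [CharP k p] in
/-- Preimages commute with finite infima of opens. [folklore] -/
theorem preimage_finset_inf {X Y : Scheme.{0}} (f : X ⟶ Y) {ι : Type} [DecidableEq ι] (S : Finset ι)
    (g : ι → Y.Opens) : f ⁻¹ᵁ (S.inf g) = S.inf (fun l => f ⁻¹ᵁ g l) := by
  induction S using Finset.induction_on with
  | empty => rfl
  | insert a S ha ih => rw [Finset.inf_insert, Finset.inf_insert, ← ih]; rfl

include hσ in
/-- **Every piece `O_{i,I}` is `⟨σ⟩`-stable.** [OURS · L1 W4.5c] -/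
theorem preimage_piece_eq
    (ρ : ↥(Subgroup.zpowers σ) →* Aut (Spec (CommRingCat.of (CoreRing k p n))))
    (hρ : ∀ γ : ↥(Subgroup.zpowers σ), (ρ γ).hom = Spec.map (CommRingCat.ofHom
      ((MulSemiringAction.toRingEquiv (↥(Subgroup.zpowers σ)) (CoreRing k p n) γ⁻¹ :
        CoreRing k p n ≃+* CoreRing k p n) : CoreRing k p n →+* CoreRing k p n)))
    (hJ : ∀ γ : ↥(Subgroup.zpowers σ),
      (affineBlowup.idealSheaf (Ideal.span (Set.range (coreU k p n)))).comap (ρ γ).hom =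
        affineBlowup.idealSheaf (Ideal.span (Set.range (coreU k p n))))
    (γ : ↥(Subgroup.zpowers σ)) (i : Fin n) (I : Finset (Fin n)) :
    (((affineBlowup.isBlowup (Ideal.span (Set.range (coreU k p n)))).liftAction ρ hJ) γ).hom ⁻¹ᵁ
        (D₊ (pieceElt i I)) = (D₊ (pieceElt i I)) := by
  have hvert : ∀ l : Fin n,
      (((affineBlowup.isBlowup (Ideal.span (Set.range (coreU k p n)))).liftAction ρ hJ) γ).hom ⁻¹ᵁ
        (D₊ (uT l)) = (D₊ (uT l)) :=
    fun l => preimage_coreVertexChart_eq k p n σ hσ ρ hρ hJ γ l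
  have hdiff : ∀ l : Fin n,
      (((affineBlowup.isBlowup (Ideal.span (Set.range (coreU k p n)))).liftAction ρ hJ) γ).hom ⁻¹ᵁ
        (D₊ (dT i l)) = (D₊ (dT i l)) :=
    fun l => BlowupExit.preimage_basicOpen_reesT_eq_of_units σ ρ hρ hJ _ _ _
      (sigma_coreDiff_eq_mul_unit k p n σ hσ i l) (symm_coreDiff_eq_mul_unit k p n σ hσ i l) γ
  rw [piece_eq_inf, Scheme.Hom.preimage_inf, Scheme.Hom.preimage_inf, preimage_finset_inf, preimage_finset_inf,
    hvert]
  simp_rw [hvert, hdiff]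

/-! ## The cover -/

omit [Fact p.Prime] [CharP k p] in
/-- Membership in a finite infimum of opens. [folklore] -/
theorem mem_finset_inf_opens {X : Type} [TopologicalSpace X] {ι : Type} [DecidableEq ι] (S : Finset ι)
    (g : ι → Opens X) (x : X) : x ∈ S.inf g ↔ ∀ l ∈ S, x ∈ g l := by
  induction S using Finset.induction_on with
  | empty => simp
  | insert a S ha ih => rw [Finset.inf_insert, Opens.mem_inf, ih]; simp

omit [Fact p.Prime] [CharP k p] in
/-- `(uᵢ − uₗ)t = uᵢt − uₗt` in `R[𝔪t]`. [folklore] -/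
theorem coreDiffT_eq (i l : Fin n) : (dT i l) = (uT i) - (uT l) := by
  apply Subtype.ext
  simp only [coe_reesT, AddSubgroupClass.coe_sub, map_sub]

omit [Fact p.Prime] [CharP k p] in
/-- **The pieces cover `V`**: `⨆_{I ≠ ∅} O_{min I, I} = ⊤`. [OURS · L1 W4.5c] -/
theorem iSup_piece_eq_top :
    ⨆ I : {I : Finset (Fin n) // I.Nonempty},
      (D₊ (pieceElt (I.1.min' I.2) I.1)) = ⊤ := by
  classical
  refine top_le_iff.mp fun v _ => ?_
  -- the vertex cover gives a chart containing `v`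
  have hv : v ∈ (⨆ i : Fin n, (D₊ (uT i))) := by rw [iSup_coreVertexCharts_eq_top]; trivial
  obtain ⟨i₀, hi₀⟩ := Opens.mem_iSup.mp hv
  let I : Finset (Fin n) := Finset.univ.filter fun l => v ∈ (D₊ (uT l))
  have hI : I.Nonempty := ⟨i₀, by simpa [I] using hi₀⟩
  have hmemI : ∀ l, l ∈ I ↔ v ∈ (D₊ (uT l)) := fun l => by simp [I]
  refine Opens.mem_iSup.mpr ⟨⟨I, hI⟩, ?_⟩
  have hi : v ∈ (D₊ (uT (I.min' hI))) := (hmemI _).mp (Finset.min'_mem I hI)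
  change v ∈ (D₊ (pieceElt (I.min' hI) I))
  rw [piece_eq_inf, Opens.mem_inf, Opens.mem_inf, mem_finset_inf_opens, mem_finset_inf_opens]
  refine ⟨⟨hi, fun l hl => (hmemI l).mp (Finset.mem_of_mem_erase hl)⟩, fun l hl => ?_⟩
  have hl' : v ∉ (D₊ (uT l)) := fun h => (Finset.mem_sdiff.mp hl).2 ((hmemI l).mpr h)
  rw [Proj.mem_basicOpen] at hi hl' ⊢
  rw [not_not] at hl'
  intro hmem
  apply hi
  have e : (uT (I.min' hI)) = (dT (I.min' hI) l) + (uT l) := by rw [coreDiffT_eq]; ring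
  rw [e]
  exact Ideal.add_mem _ hmem hl'

end ConductorOne

end Summit.ResolutionOfSingularities.ResolutionOfSingularities.Theorems.WildQuotientResolution

end
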